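import Summits.FinalStateConjecture.FinalStateConjecture.Theorems.UniformPhotonSphereChannels.Negative.RindlerPotential
import Mathlib.Analysis.Complex.ExponentialBounds

/-!
# Crux `UniformPhotonSphereChannels` (K1), negative side — the horizon-frame mass on the region
# of the witness

Support file of the standing disprover of item stmt-FinalStateConjecture-10045.  For the spin-1
potential in the Rindler chart, `W(T,X) = V(x)α′(X+T)α′(X−T)`, on `{A₀ < X − |T|}`:
`W ≥ W_min = L/27M²` where `X ≤ 4M`, `|∂W| ≤ D = e^{1/2}(Le^{1/2}/8M²)(4X_e/3)/(4M²)` where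
`X ≤ 4X_e/3`, and the smallness `(X_e/3)·D ≤ W_min/4` once `X_e ≤ M/3` (`chart_bounds`) — the
hypotheses of the pinning and flux lemmas on the triangles of the witness. [folklore]
-/

namespace Summit.FinalStateConjecture.FinalStateConjecture.Theorems

open Set Filter Topology Literature.Geometry.Lorentzian.ReggeWheeler

noncomputable section

namespace WaveDefect

/-- `e^{1/2} · e^{1/2} ≤ 3`. -/
theorem exp_half_mul_self_le : Real.exp (1 / 2) * Real.exp (1 / 2) ≤ 3 := by
  rw [← Real.exp_add, show (1 / 2 : ℝ) + 1 / 2 = 1 by norm_num]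
  have := Real.exp_one_lt_three
  linarith

/-- **Mass bounds, slow variation and smallness on the region of the witness.** -/
theorem chart_bounds {M : ℝ} {r : ℝ → ℝ} (h : IsTortoiseRadius M r 0) {L : ℝ} (hL : 0 < L)
    {A₀ Xe : ℝ} (hA₀ : 0 ≤ A₀) (hXe0 : 0 < Xe) (hsmallX : Xe ≤ M / 3)
    {α : ℝ → ℝ} (hα : ContDiff ℝ 2 α)
    (hαlog : ∀ a, A₀ < a → α a = Real.log (1 / (4 * M) * a) / (1 / (4 * M)))
    (hα' : ∀ a, A₀ < a → deriv α a = 1 / (1 / (4 * M) * a))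
    {Wmin D : ℝ} (hWmin : Wmin = L / (27 * M ^ 2))
    (hD : D = Real.exp (1 / 2) * (L * Real.exp (1 / 2) / (8 * M ^ 2)) * (4 / 3 * Xe) / (4 * M ^ 2)) :
    (∀ z : ℝ × ℝ, A₀ < z.2 - |z.1| → z.2 ≤ 4 * M → Wmin ≤
      (1 - 2 * M / r ((α (z.2 + z.1) + α (z.2 - z.1)) / 2))
        * (L / r ((α (z.2 + z.1) + α (z.2 - z.1)) / 2) ^ 2)
        * deriv α (z.2 + z.1) * deriv α (z.2 - z.1)) ∧
    0 ≤ D ∧ 0 < Wmin ∧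
    (∀ z : ℝ × ℝ, A₀ < z.2 - |z.1| → z.2 ≤ 4 / 3 * Xe →
      |fderiv ℝ (fun w : ℝ × ℝ => (1 - 2 * M / r ((α (w.2 + w.1) + α (w.2 - w.1)) / 2))
        * (L / r ((α (w.2 + w.1) + α (w.2 - w.1)) / 2) ^ 2)
        * deriv α (w.2 + w.1) * deriv α (w.2 - w.1)) z (1, 0)| ≤ D ∧
      |fderiv ℝ (fun w : ℝ × ℝ => (1 - 2 * M / r ((α (w.2 + w.1) + α (w.2 - w.1)) / 2))
        * (L / r ((α (w.2 + w.1) + α (w.2 - w.1)) / 2) ^ 2)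
        * deriv α (w.2 + w.1) * deriv α (w.2 - w.1)) z (0, 1)| ≤ D) ∧
    Xe / 3 * D ≤ Wmin / 4 := by
  have hM := h.mass_pos
  have hDnn : 0 ≤ D := by rw [hD]; positivity
  have hWmin0 : 0 < Wmin := by rw [hWmin]; positivity
  refine ⟨fun z hz hz4 => ?_, hDnn, hWmin0, fun z hz hzb => ?_, ?_⟩
  · rw [hWmin]
    exact (RWNear.W_bounds (T := z.1) (X := z.2) h hL.le hαlog hα' hA₀ hz).2 hz4
  · have hb := RWNear.W_fderiv_bounds (T := z.1) (X := z.2) h hL.le hα hαlog hα' hA₀ hz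
    have hmono : Real.exp (1 / 2) * (L * Real.exp (1 / 2) / (8 * M ^ 2)) * z.2 / (4 * M ^ 2) ≤ D := by
      rw [hD]
      have hc : 0 ≤ Real.exp (1 / 2) * (L * Real.exp (1 / 2) / (8 * M ^ 2)) := by positivity
      exact div_le_div_of_nonneg_right (mul_le_mul_of_nonneg_left hzb hc) (by positivity)
    exact ⟨hb.1.trans hmono, hb.2.trans hmono⟩
  · have hee := exp_half_mul_self_le
    have hDle : D ≤ L * Xe / (8 * M ^ 4) := by
      rw [hD]
      have e1 : Real.exp (1 / 2) * (L * Real.exp (1 / 2) / (8 * M ^ 2)) * (4 / 3 * Xe) / (4 * M ^ 2)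
          = (Real.exp (1 / 2) * Real.exp (1 / 2)) * (L * Xe / (24 * M ^ 4)) := by
        field_simp; ring
      rw [e1]
      have h3 : (Real.exp (1 / 2) * Real.exp (1 / 2)) * (L * Xe / (24 * M ^ 4))
          ≤ 3 * (L * Xe / (24 * M ^ 4)) := mul_le_mul_of_nonneg_right hee (by positivity)
      have e2 : 3 * (L * Xe / (24 * M ^ 4)) = L * Xe / (8 * M ^ 4) := by field_simp; ring
      linarith
    have hXe2 : Xe * Xe ≤ M / 3 * (M / 3) := mul_le_mul hsmallX hsmallX hXe0.le (by positivity)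
    rw [hWmin, div_div]
    calc Xe / 3 * D ≤ Xe / 3 * (L * Xe / (8 * M ^ 4)) :=
          mul_le_mul_of_nonneg_left hDle (by positivity)
      _ = L / (24 * M ^ 4) * (Xe * Xe) := by ring
      _ ≤ L / (24 * M ^ 4) * (M / 3 * (M / 3)) := mul_le_mul_of_nonneg_left hXe2 (by positivity)
      _ = L / (216 * M ^ 2) := by field_simp; ring
      _ ≤ L / (27 * M ^ 2 * 4) := div_le_div_of_nonneg_left hL.le (by positivity) (by nlinarith)

end WaveDefect

end

end Summit.FinalStateConjecture.FinalStateConjecture.Theorems
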